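import Summits.CriticalPhenomena.CardyFormulaZ2.Theses.CardyGluingRDE
import Literature.Probability.Percolation.CardyFormulaConformalInvariance
import Literature.Probability.RandomPlanarGeometry.ConformalRectangleProofs

/-!
# Route `CardyGluingRDE`, item `MergingGivesPolygonCardy` (stmt-CriticalPhenomena-8584): the glue,
# and what it is glue for

The route item is the bare implication `BoxMerging → CardyLatticePolygon` ("polyomino transfer").
Its printed plan has four steps: (i)–(ii) POLYOMINO SHADOWING on both lattices (the crossing event
of a lattice-polyomino conformal rectangle `R` is, up to an event of small probability, uniformly in
small mesh, a fixed function of the boundary-segment connectivity matrices of the `δ₀`-squares of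
`R`; this needs four-arm bounds `α₄ > 1` at every internal seam and junction, on `ℤ²` AND on `𝕋`),
(iii) the TV-Lipschitz transfer of `BoxMerging` through that function, (iv) Smirnov's theorem on
`𝕋` (`Literature.Probability.Percolation.hasCrossingLimit_triDomainCrossingProb_holds`, proved in
the tree).

This file proves the GLUE (iii)+(iv) once and for all, against the weakest interface that makes it
work, and records why the item cannot be refuted:

* `MergingGivesPolygonCardy_of_transfer` — if, for every lattice-polyomino conformal rectangle `R`
  and every `ε > 0`, `η'`-closeness in total variation of the bond-`ℤ²` and site-`𝕋` laws of the
  resolution-`j` boundary-segment matrix of the square `(0, δ₀)²`, at SOME resolution `j` and for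
  SOME `η' > 0`, forces `|bondDomainCrossingProb R u - triDomainCrossingProb R u'| ≤ ε` for all
  small meshes `u, u'` (hypothesis `hT`, "polyomino transfer"; its `let`s are those of
  `BoxMerging`, verbatim), then `MergingGivesPolygonCardy`.  Proof: `BoxMerging` supplies the
  closeness, Smirnov's theorem the `𝕋`-limit `cardyFunction η`, an `ε/3` argument the `ℤ²`-limit.
* `MergingGivesPolygonCardy_of_jointShadowing` — the intended mechanism: if both crossing
  probabilities are shadowed, up to `ε`, by ONE functional `G` of the respective square laws,
  uniformly continuous in total variation on `[0,1]`-valued vectors (in the plan: the probability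
  of a glued chain under the `|s|`-fold product of the square law), then `hT` holds, hence the item.
* `MergingGivesPolygonCardy_of_cardyLatticePolygon`, `MergingGivesPolygonCardy_of_cardyFormulaZ2`
  — the item follows from the route target, hence from the sub-problem statement itself: no
  refutation of the item exists unless `CardyFormulaZ2` is false.

What is NOT here: the shadowing estimates themselves (steps (i)–(ii)), which are crux-sized
(cf. the route's crux `JunctionShadowingT`: one straight seam, on `ℤ²` only).
-/

namespace Summit.CriticalPhenomena.CardyFormulaZ2.Theorems

open scoped BigOperators Topology
open Filter Set MeasureTheory
open Literature.Probability.Percolation Literature.Probability.RandomPlanarGeometry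
open Summit.CriticalPhenomena.CardyFormulaZ2.Theses.CardyGluingRDE

/-- **The item follows from the route target.** `CardyLatticePolygon → MergingGivesPolygonCardy`
(`B → (A → B)`): a refutation of the item would refute the target. -/
theorem MergingGivesPolygonCardy_of_cardyLatticePolygon (h : CardyLatticePolygon) :
    MergingGivesPolygonCardy :=
  fun _ => h

/-- **The item follows from the sub-problem statement** `CardyFormulaZ2` (Cardy's formula for every
conformal rectangle gives it in particular for lattice polyominoes): the item is irrefutable unless
the conjunct is false. -/
theorem MergingGivesPolygonCardy_of_cardyFormulaZ2 (h : _root_.CardyFormulaZ2) :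
    MergingGivesPolygonCardy :=
  fun _ R _ => h R

/-- **The glue of the polyomino transfer.** Hypothesis `hT` ("polyomino transfer", the content of
steps (i)–(iii) of the item's plan, stated as an interface): for every conformal rectangle `R` whose
carrier is the interior of a finite union of closed `δ₀`-squares and whose marks are `δ₀`-lattice
points, and every `ε > 0`, there are a resolution `j`, a tolerance `η' > 0` and a mesh onset `η > 0`
such that for all meshes `0 < u, u' < η`: if the bond-`ℤ²` (mesh `u`) and site-`𝕋` (mesh `u'`)
laws of the resolution-`j` boundary-segment connectivity matrix of the square `(0, δ₀)²` are within
`η'` in total variation (`TV δ₀ j u u' ≤ η'`), then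
`|bondDomainCrossingProb R u - triDomainCrossingProb R u'| ≤ ε`.  The `let`s
`PZ PT Sq seg EZ ET TV` are those of `BoxMerging`, verbatim.  Conclusion: the route item
`MergingGivesPolygonCardy : BoxMerging → CardyLatticePolygon` — `BoxMerging` gives `TV ≤ η'` at
resolution `j` for small meshes, Smirnov's theorem (`hasCrossingLimit_triDomainCrossingProb_holds`)
the `𝕋`-side limit `cardyFunction (crossRatio x)`, and an `ε/3`-argument the `ℤ²`-side limit. -/
theorem MergingGivesPolygonCardy_of_transfer
    (hT :
      let PZ := Literature.Probability.Percolation.bondPercolation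
        (Literature.Probability.LatticeModels.zdGraph 2) Literature.Probability.Percolation.half
      let PT := Literature.Probability.LatticeModels.triSitePercolation
        Literature.Probability.Percolation.half
      let Sq : ℝ → Set ℂ := fun δ₀ => {z : ℂ | 0 < z.re ∧ z.re < δ₀ ∧ 0 < z.im ∧ z.im < δ₀}
      let seg : (δ₀ : ℝ) → (j : ℕ) → Fin 4 × Fin (2 ^ j) → Set ℂ := fun δ₀ j a =>
        {z : ℂ | (a.1 = 0 ∧ z.im = 0 ∧ δ₀ * ((a.2 : ℕ) : ℝ) / 2 ^ j ≤ z.re ∧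
            z.re ≤ δ₀ * (((a.2 : ℕ) : ℝ) + 1) / 2 ^ j) ∨
          (a.1 = 1 ∧ z.re = δ₀ ∧ δ₀ * ((a.2 : ℕ) : ℝ) / 2 ^ j ≤ z.im ∧
            z.im ≤ δ₀ * (((a.2 : ℕ) : ℝ) + 1) / 2 ^ j) ∨
          (a.1 = 2 ∧ z.im = δ₀ ∧ δ₀ * ((a.2 : ℕ) : ℝ) / 2 ^ j ≤ z.re ∧
            z.re ≤ δ₀ * (((a.2 : ℕ) : ℝ) + 1) / 2 ^ j) ∨
          (a.1 = 3 ∧ z.re = 0 ∧ δ₀ * ((a.2 : ℕ) : ℝ) / 2 ^ j ≤ z.im ∧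
            z.im ≤ δ₀ * (((a.2 : ℕ) : ℝ) + 1) / 2 ^ j)}
      let EZ : (δ₀ : ℝ) → (j : ℕ) → ℝ → ((Fin 4 × Fin (2 ^ j)) → (Fin 4 × Fin (2 ^ j)) → Bool) →
          Set (Literature.Probability.Percolation.BondConfig
            (Literature.Probability.LatticeModels.Site 2)) := fun δ₀ j u M =>
        {ω | ∀ a b, ω ∈ Literature.Probability.Percolation.discreteCrossing (Sq δ₀) u (seg δ₀ j a)
          (seg δ₀ j b) ↔ M a b = true}
      let ET : (δ₀ : ℝ) → (j : ℕ) → ℝ → ((Fin 4 × Fin (2 ^ j)) → (Fin 4 × Fin (2 ^ j)) → Bool) →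
          Set (Literature.Probability.Percolation.SiteConfig
            (Literature.Probability.LatticeModels.Site 2)) := fun δ₀ j u M =>
        {ω | ∀ a b, ω ∈ Literature.Probability.LatticeModels.triCrossing (Sq δ₀) u (seg δ₀ j a)
          (seg δ₀ j b) ↔ M a b = true}
      let TV : ℝ → ℕ → ℝ → ℝ → ℝ := fun δ₀ j u u' => (1 / 2 : ℝ) *
        ∑ M : (Fin 4 × Fin (2 ^ j)) → (Fin 4 × Fin (2 ^ j)) → Bool,
          |PZ.real (EZ δ₀ j u M) - PT.real (ET δ₀ j u' M)|
      ∀ R : ConformalRectangle, ∀ δ₀ : ℝ, 0 < δ₀ →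
        (∃ s : Finset (ℤ × ℤ), R.carrier = interior (⋃ p ∈ s, {z : ℂ | δ₀ * (p.1 : ℝ) ≤ z.re ∧
          z.re ≤ δ₀ * ((p.1 : ℝ) + 1) ∧ δ₀ * (p.2 : ℝ) ≤ z.im ∧ z.im ≤ δ₀ * ((p.2 : ℝ) + 1)})) →
        (∀ i, ∃ m n : ℤ, R.pt i = (δ₀ : ℂ) * ((m : ℂ) + (n : ℂ) * Complex.I)) →
        ∀ ε : ℝ, 0 < ε → ∃ j : ℕ, ∃ η' : ℝ, 0 < η' ∧ ∃ η : ℝ, 0 < η ∧ ∀ u u' : ℝ,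
          0 < u → u < η → 0 < u' → u' < η → TV δ₀ j u u' ≤ η' →
          |bondDomainCrossingProb R u - triDomainCrossingProb R u'| ≤ ε) :
    MergingGivesPolygonCardy := by
  intro hBM R hR φ x hux
  obtain ⟨δ₀, hδ₀, hs, hmarks⟩ := hR
  have htri := hasCrossingLimit_triDomainCrossingProb_holds R φ x hux
  rw [Metric.tendsto_nhdsWithin_nhds] at htri ⊢
  intro ε hε
  have hε3 : 0 < ε / 3 := by positivity
  obtain ⟨j, η', hη', η, hη, hclose⟩ := hT R δ₀ hδ₀ hs hmarks (ε / 3) hε3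
  obtain ⟨η₂, hη₂, hBM'⟩ := hBM δ₀ hδ₀ j η' hη'
  obtain ⟨η₃, hη₃, htri'⟩ := htri (ε / 3) hε3
  refine ⟨min η η₂, lt_min hη hη₂, fun u hu hdist => ?_⟩
  -- a fixed small `𝕋`-mesh `u'`
  have hm : 0 < min (min η η₂) η₃ := lt_min (lt_min hη hη₂) hη₃
  set u' : ℝ := min (min η η₂) η₃ / 2 with hu'
  have hu'pos : 0 < u' := by positivity
  have hu'lt : u' < min (min η η₂) η₃ := by rw [hu']; linarith
  have hu'η : u' < η := hu'lt.trans_le ((min_le_left _ _).trans (min_le_left _ _))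
  have hu'η₂ : u' < η₂ := hu'lt.trans_le ((min_le_left _ _).trans (min_le_right _ _))
  have hu'η₃ : u' < η₃ := hu'lt.trans_le (min_le_right _ _)
  have hupos : 0 < u := hu
  rw [Real.dist_eq, sub_zero, abs_of_pos hupos] at hdist
  have huη : u < η := hdist.trans_le (min_le_left _ _)
  have huη₂ : u < η₂ := hdist.trans_le (min_le_right _ _)
  -- `BoxMerging` at resolution `j`: the two square laws are `η'`-close
  have hsum := hBM' u u' hupos huη₂ hu'pos hu'η₂
  -- the transfer: the two polyomino crossing probabilities are `ε/3`-close
  have h1 : |bondDomainCrossingProb R u - triDomainCrossingProb R u'| ≤ ε / 3 :=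
    hclose u u' hupos huη hu'pos hu'η hsum
  -- Smirnov on `𝕋`: the `𝕋` crossing probability at mesh `u'` is `ε/3`-close to Cardy's value
  set c : ℝ := Literature.Probability.RandomPlanarGeometry.cardyFunction (crossRatio x)
  have h2 : dist (triDomainCrossingProb R u') c < ε / 3 :=
    htri' (show u' ∈ Ioi (0 : ℝ) from hu'pos) (by rwa [Real.dist_eq, sub_zero, abs_of_pos hu'pos])
  rw [Real.dist_eq] at h2 ⊢
  calc |bondDomainCrossingProb R u - c|
      = |(bondDomainCrossingProb R u - triDomainCrossingProb R u') +
          (triDomainCrossingProb R u' - c)| := by ring_nf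
    _ ≤ |bondDomainCrossingProb R u - triDomainCrossingProb R u'| +
          |triDomainCrossingProb R u' - c| := abs_add_le _ _
    _ < ε := by linarith

/-- **The transfer hypothesis is implied by the route target** (so, given `BoxMerging`, it is
EQUIVALENT to `CardyLatticePolygon`, by `MergingGivesPolygonCardy_of_transfer`): if Cardy's formula
holds for lattice polyominoes on bond-`ℤ²`, then both crossing probabilities of such an `R` converge
to the same Cardy value (Smirnov's theorem on `𝕋`, `hasCrossingLimit_triDomainCrossingProb_holds`;
uniformizing data exist, `MarkedDomain.exists_isUniformizing_holds`), hence are eventually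
`ε`-close whatever the square laws do (take `j = 0`, `η' = 1`).  Filing the transfer hypothesis as
the crux of this glue therefore loses nothing.  Same verbatim `let`s as `BoxMerging`. -/
theorem transfer_of_cardyLatticePolygon (h : CardyLatticePolygon) :
    let PZ := Literature.Probability.Percolation.bondPercolation
      (Literature.Probability.LatticeModels.zdGraph 2) Literature.Probability.Percolation.half
    let PT := Literature.Probability.LatticeModels.triSitePercolation
      Literature.Probability.Percolation.half
    let Sq : ℝ → Set ℂ := fun δ₀ => {z : ℂ | 0 < z.re ∧ z.re < δ₀ ∧ 0 < z.im ∧ z.im < δ₀}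
    let seg : (δ₀ : ℝ) → (j : ℕ) → Fin 4 × Fin (2 ^ j) → Set ℂ := fun δ₀ j a =>
      {z : ℂ | (a.1 = 0 ∧ z.im = 0 ∧ δ₀ * ((a.2 : ℕ) : ℝ) / 2 ^ j ≤ z.re ∧
          z.re ≤ δ₀ * (((a.2 : ℕ) : ℝ) + 1) / 2 ^ j) ∨
        (a.1 = 1 ∧ z.re = δ₀ ∧ δ₀ * ((a.2 : ℕ) : ℝ) / 2 ^ j ≤ z.im ∧
          z.im ≤ δ₀ * (((a.2 : ℕ) : ℝ) + 1) / 2 ^ j) ∨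
        (a.1 = 2 ∧ z.im = δ₀ ∧ δ₀ * ((a.2 : ℕ) : ℝ) / 2 ^ j ≤ z.re ∧
          z.re ≤ δ₀ * (((a.2 : ℕ) : ℝ) + 1) / 2 ^ j) ∨
        (a.1 = 3 ∧ z.re = 0 ∧ δ₀ * ((a.2 : ℕ) : ℝ) / 2 ^ j ≤ z.im ∧
          z.im ≤ δ₀ * (((a.2 : ℕ) : ℝ) + 1) / 2 ^ j)}
    let EZ : (δ₀ : ℝ) → (j : ℕ) → ℝ → ((Fin 4 × Fin (2 ^ j)) → (Fin 4 × Fin (2 ^ j)) → Bool) →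
        Set (Literature.Probability.Percolation.BondConfig
          (Literature.Probability.LatticeModels.Site 2)) := fun δ₀ j u M =>
      {ω | ∀ a b, ω ∈ Literature.Probability.Percolation.discreteCrossing (Sq δ₀) u (seg δ₀ j a)
        (seg δ₀ j b) ↔ M a b = true}
    let ET : (δ₀ : ℝ) → (j : ℕ) → ℝ → ((Fin 4 × Fin (2 ^ j)) → (Fin 4 × Fin (2 ^ j)) → Bool) →
        Set (Literature.Probability.Percolation.SiteConfig
          (Literature.Probability.LatticeModels.Site 2)) := fun δ₀ j u M =>
      {ω | ∀ a b, ω ∈ Literature.Probability.LatticeModels.triCrossing (Sq δ₀) u (seg δ₀ j a)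
        (seg δ₀ j b) ↔ M a b = true}
    let TV : ℝ → ℕ → ℝ → ℝ → ℝ := fun δ₀ j u u' => (1 / 2 : ℝ) *
      ∑ M : (Fin 4 × Fin (2 ^ j)) → (Fin 4 × Fin (2 ^ j)) → Bool,
        |PZ.real (EZ δ₀ j u M) - PT.real (ET δ₀ j u' M)|
    ∀ R : ConformalRectangle, ∀ δ₀ : ℝ, 0 < δ₀ →
      (∃ s : Finset (ℤ × ℤ), R.carrier = interior (⋃ p ∈ s, {z : ℂ | δ₀ * (p.1 : ℝ) ≤ z.re ∧
        z.re ≤ δ₀ * ((p.1 : ℝ) + 1) ∧ δ₀ * (p.2 : ℝ) ≤ z.im ∧ z.im ≤ δ₀ * ((p.2 : ℝ) + 1)})) →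
      (∀ i, ∃ m n : ℤ, R.pt i = (δ₀ : ℂ) * ((m : ℂ) + (n : ℂ) * Complex.I)) →
      ∀ ε : ℝ, 0 < ε → ∃ j : ℕ, ∃ η' : ℝ, 0 < η' ∧ ∃ η : ℝ, 0 < η ∧ ∀ u u' : ℝ,
        0 < u → u < η → 0 < u' → u' < η → TV δ₀ j u u' ≤ η' →
        |bondDomainCrossingProb R u - triDomainCrossingProb R u'| ≤ ε := by
  intro PZ PT Sq seg EZ ET TV R δ₀ hδ₀ hs hmarks ε hε
  obtain ⟨φ, x, hux⟩ := MarkedDomain.exists_isUniformizing_holds R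
  have hb := h R ⟨δ₀, hδ₀, hs, hmarks⟩ φ x hux
  have ht := hasCrossingLimit_triDomainCrossingProb_holds R φ x hux
  rw [Metric.tendsto_nhdsWithin_nhds] at hb ht
  have hε2 : 0 < ε / 2 := by positivity
  obtain ⟨ηb, hηb, hb'⟩ := hb (ε / 2) hε2
  obtain ⟨ηt, hηt, ht'⟩ := ht (ε / 2) hε2
  refine ⟨0, 1, one_pos, min ηb ηt, lt_min hηb hηt, fun u u' hu huη hu' hu'η _ => ?_⟩
  set c : ℝ := Literature.Probability.RandomPlanarGeometry.cardyFunction (crossRatio x)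
  have h1 : dist (bondDomainCrossingProb R u) c < ε / 2 :=
    hb' (show u ∈ Ioi (0 : ℝ) from hu)
      (by rw [Real.dist_eq, sub_zero, abs_of_pos hu]; exact huη.trans_le (min_le_left _ _))
  have h2 : dist (triDomainCrossingProb R u') c < ε / 2 :=
    ht' (show u' ∈ Ioi (0 : ℝ) from hu')
      (by rw [Real.dist_eq, sub_zero, abs_of_pos hu']; exact hu'η.trans_le (min_le_right _ _))
  rw [Real.dist_eq] at h1 h2
  rw [abs_sub_comm] at h2
  calc |bondDomainCrossingProb R u - triDomainCrossingProb R u'|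
      = |(bondDomainCrossingProb R u - c) + (c - triDomainCrossingProb R u')| := by ring_nf
    _ ≤ |bondDomainCrossingProb R u - c| + |c - triDomainCrossingProb R u'| := abs_add_le _ _
    _ ≤ ε := by linarith

/-- **The intended mechanism gives the transfer, hence the item.** Hypothesis `hS` ("joint
polyomino shadowing"): for every lattice-polyomino conformal rectangle `R` (side `δ₀`, marks on
`δ₀ℤ²`) and every `ε > 0` there are a resolution `j` and ONE functional `G` of a real vector indexed
by the resolution-`j` segment matrices, uniformly continuous at precision `ε` in total variation on
`[0,1]`-valued vectors (tolerance `ρ > 0`), which shadows BOTH crossing probabilities up to `ε` for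
all small meshes: `|bondDomainCrossingProb R u - G (law of the bond-ℤ² square matrix at mesh u)| ≤ ε`
and `|triDomainCrossingProb R u' - G (law of the site-𝕋 square matrix at mesh u')| ≤ ε`.  In the
item's plan `G μ` is the probability, under the `|s|`-fold product of `μ`, that the glued-chain map
joins the segments of `R.arc 0` to those of `R.arc 2` (then `G` is `|s|`-Lipschitz in total
variation), and the two shadowing estimates are the seam/junction four-arm bounds on `ℤ²` and on
`𝕋`; none of that is proved here.  The `let`s `PZ PT Sq seg EZ ET` are those of `BoxMerging`,
verbatim.  Conclusion: `MergingGivesPolygonCardy`, through `MergingGivesPolygonCardy_of_transfer`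
(triangle inequality through `G`; the square laws are `[0,1]`-valued because `P_{1/2}` on either
lattice is a probability measure). -/
theorem MergingGivesPolygonCardy_of_jointShadowing
    (hS :
      let PZ := Literature.Probability.Percolation.bondPercolation
        (Literature.Probability.LatticeModels.zdGraph 2) Literature.Probability.Percolation.half
      let PT := Literature.Probability.LatticeModels.triSitePercolation
        Literature.Probability.Percolation.half
      let Sq : ℝ → Set ℂ := fun δ₀ => {z : ℂ | 0 < z.re ∧ z.re < δ₀ ∧ 0 < z.im ∧ z.im < δ₀}
      let seg : (δ₀ : ℝ) → (j : ℕ) → Fin 4 × Fin (2 ^ j) → Set ℂ := fun δ₀ j a =>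
        {z : ℂ | (a.1 = 0 ∧ z.im = 0 ∧ δ₀ * ((a.2 : ℕ) : ℝ) / 2 ^ j ≤ z.re ∧
            z.re ≤ δ₀ * (((a.2 : ℕ) : ℝ) + 1) / 2 ^ j) ∨
          (a.1 = 1 ∧ z.re = δ₀ ∧ δ₀ * ((a.2 : ℕ) : ℝ) / 2 ^ j ≤ z.im ∧
            z.im ≤ δ₀ * (((a.2 : ℕ) : ℝ) + 1) / 2 ^ j) ∨
          (a.1 = 2 ∧ z.im = δ₀ ∧ δ₀ * ((a.2 : ℕ) : ℝ) / 2 ^ j ≤ z.re ∧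
            z.re ≤ δ₀ * (((a.2 : ℕ) : ℝ) + 1) / 2 ^ j) ∨
          (a.1 = 3 ∧ z.re = 0 ∧ δ₀ * ((a.2 : ℕ) : ℝ) / 2 ^ j ≤ z.im ∧
            z.im ≤ δ₀ * (((a.2 : ℕ) : ℝ) + 1) / 2 ^ j)}
      let EZ : (δ₀ : ℝ) → (j : ℕ) → ℝ → ((Fin 4 × Fin (2 ^ j)) → (Fin 4 × Fin (2 ^ j)) → Bool) →
          Set (Literature.Probability.Percolation.BondConfig
            (Literature.Probability.LatticeModels.Site 2)) := fun δ₀ j u M =>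
        {ω | ∀ a b, ω ∈ Literature.Probability.Percolation.discreteCrossing (Sq δ₀) u (seg δ₀ j a)
          (seg δ₀ j b) ↔ M a b = true}
      let ET : (δ₀ : ℝ) → (j : ℕ) → ℝ → ((Fin 4 × Fin (2 ^ j)) → (Fin 4 × Fin (2 ^ j)) → Bool) →
          Set (Literature.Probability.Percolation.SiteConfig
            (Literature.Probability.LatticeModels.Site 2)) := fun δ₀ j u M =>
        {ω | ∀ a b, ω ∈ Literature.Probability.LatticeModels.triCrossing (Sq δ₀) u (seg δ₀ j a)
          (seg δ₀ j b) ↔ M a b = true}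
      ∀ R : ConformalRectangle, ∀ δ₀ : ℝ, 0 < δ₀ →
        (∃ s : Finset (ℤ × ℤ), R.carrier = interior (⋃ p ∈ s, {z : ℂ | δ₀ * (p.1 : ℝ) ≤ z.re ∧
          z.re ≤ δ₀ * ((p.1 : ℝ) + 1) ∧ δ₀ * (p.2 : ℝ) ≤ z.im ∧ z.im ≤ δ₀ * ((p.2 : ℝ) + 1)})) →
        (∀ i, ∃ m n : ℤ, R.pt i = (δ₀ : ℂ) * ((m : ℂ) + (n : ℂ) * Complex.I)) →
        ∀ ε : ℝ, 0 < ε → ∃ j : ℕ,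
          ∃ G : (((Fin 4 × Fin (2 ^ j)) → (Fin 4 × Fin (2 ^ j)) → Bool) → ℝ) → ℝ,
          (∃ ρ : ℝ, 0 < ρ ∧ ∀ f g : ((Fin 4 × Fin (2 ^ j)) → (Fin 4 × Fin (2 ^ j)) → Bool) → ℝ,
            (∀ M, f M ∈ Icc (0 : ℝ) 1) → (∀ M, g M ∈ Icc (0 : ℝ) 1) →
            (1 / 2 : ℝ) * ∑ M : (Fin 4 × Fin (2 ^ j)) → (Fin 4 × Fin (2 ^ j)) → Bool, |f M - g M| ≤ ρ →
            |G f - G g| ≤ ε) ∧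
          ∃ η : ℝ, 0 < η ∧
            (∀ u : ℝ, 0 < u → u < η →
              |bondDomainCrossingProb R u - G (fun M => PZ.real (EZ δ₀ j u M))| ≤ ε) ∧
            (∀ u' : ℝ, 0 < u' → u' < η →
              |triDomainCrossingProb R u' - G (fun M => PT.real (ET δ₀ j u' M))| ≤ ε)) :
    MergingGivesPolygonCardy := by
  refine MergingGivesPolygonCardy_of_transfer ?_
  intro PZ PT Sq seg EZ ET TV R δ₀ hδ₀ hs hmarks ε hε
  have hε3 : 0 < ε / 3 := by positivity
  obtain ⟨j, G, ⟨ρ, hρ, hG⟩, η, hη, hZ, hT⟩ := hS R δ₀ hδ₀ hs hmarks (ε / 3) hε3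
  refine ⟨j, ρ, hρ, η, hη, fun u u' hu huη hu' hu'η hTV => ?_⟩
  -- the two reading vectors are `[0,1]`-valued
  have hfZ : ∀ M, PZ.real (EZ δ₀ j u M) ∈ Icc (0 : ℝ) 1 :=
    fun M => ⟨measureReal_nonneg, measureReal_le_one⟩
  have hfT : ∀ M, PT.real (ET δ₀ j u' M) ∈ Icc (0 : ℝ) 1 :=
    fun M => ⟨measureReal_nonneg, measureReal_le_one⟩
  have h1 := hZ u hu huη
  have h2 := hT u' hu' hu'η
  have h3 : |G (fun M => PZ.real (EZ δ₀ j u M)) - G (fun M => PT.real (ET δ₀ j u' M))| ≤ ε / 3 :=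
    hG _ _ hfZ hfT hTV
  rw [abs_sub_comm] at h2
  calc |bondDomainCrossingProb R u - triDomainCrossingProb R u'|
      = |(bondDomainCrossingProb R u - G (fun M => PZ.real (EZ δ₀ j u M))) +
          (G (fun M => PZ.real (EZ δ₀ j u M)) - G (fun M => PT.real (ET δ₀ j u' M))) +
          (G (fun M => PT.real (ET δ₀ j u' M)) - triDomainCrossingProb R u')| := by ring_nf
    _ ≤ |bondDomainCrossingProb R u - G (fun M => PZ.real (EZ δ₀ j u M))| +
          |G (fun M => PZ.real (EZ δ₀ j u M)) - G (fun M => PT.real (ET δ₀ j u' M))| +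
          |G (fun M => PT.real (ET δ₀ j u' M)) - triDomainCrossingProb R u'| :=
        (abs_add_le _ _).trans (add_le_add (abs_add_le _ _) le_rfl)
    _ ≤ ε := by linarith

end Summit.CriticalPhenomena.CardyFormulaZ2.Theorems
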